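import Literature.Analysis.FluidPDE.RusinSverakSingularPointsStableThreeLeaves
import Literature.Analysis.FluidPDE.JiaSverak2013AprioriEstimateProofs
import Literature.Analysis.FluidPDE.JiaSverak2013Lemma8Holds
import Literature.Analysis.FluidPDE.LocalLerayLimitIdentification
import HarnessLib

/-!
# Rusin–Šverák's stability of singular points (**S**) and weak stability (**K**) — discharged

Analysis/FluidPDE proof file (no definitions, no named facts). It DISCHARGES the two named facts
of `RusinSverakLeraySolutions.lean` / `RusinSverakLerayStability.lean`:

* `rusin_sverak_leray_singular_points_stable` (**S**; W. Rusin, V. Šverák, *Minimal initial data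
  for potential Navier–Stokes singularities*, J. Funct. Anal. 260 (2011) 879–891 =
  arXiv:0911.0500, Thm. 4.2 with Lemma 2.1, as packaged by the printed proof of Cor. 4.2, p. 8),
* `rusin_sverak_leray_weak_stability` (**K**; loc. cit., Thm. 4.2 with Lemma 4.1 and Prop. 2.2),

by applying the accepted three-leaf assemblies of `RusinSverakSingularPointsStableThreeLeaves.lean`
(`rusin_sverak_leray_singular_points_stable_of_three_leaves`,
`rusin_sverak_leray_weak_stability_of_three_leaves`: **S**, **K** from Jia–Šverák 2013 Lemma 2,
Jia–Šverák 2013 Lemma 8 and the identification of the limit of local Leray solutions) to the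
three discharges that have since landed in the tree:

* `jia_sverak_2013_lemma_2_holds` (`JiaSverak2013AprioriEstimateProofs.lean`; Jia–Šverák 2013,
  Lemma 2.2 = Lemarié-Rieusset's a priori estimate = Rusin–Šverák Lemma 4.1),
* `jia_sverak_2013_lemma_8_holds` (`JiaSverak2013Lemma8Holds.lean`; the uniform initial layer),
* `localLeray_limit_isLocalLeraySolution_holds` (`LocalLerayLimitIdentification.lean`; the limit
  of local Leray solutions is a local Leray solution).

Nothing is asserted; both theorems are one-line compositions (librarian sweep `libsplit-39`,
fact decomposition 2026-08-16: the fact was found provable as filed, so it is discharged rather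
than split).

## References

* W. Rusin, V. Šverák, J. Funct. Anal. 260 (2011) 879–891, arXiv:0911.0500, Thm. 4.2, Lemma 2.1,
  Lemma 4.1, Prop. 2.2, Cor. 4.2. [RusinSverak2011]
* H. Jia, V. Šverák, J. Funct. Anal. 264 (2013), Lemma 2.2, Lemma 8, proof of Thm. 1.
-/

noncomputable section

namespace Literature.Analysis.FluidPDE

/-- **Rusin–Šverák 2011, Thm. 4.2 with Lemma 4.1 and Prop. 2.2 (weak stability of the set of
Leray solutions `NS(u₀)` under weak `Ḣ^{1/2}` convergence of the data), discharged**: the named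
fact `rusin_sverak_leray_weak_stability` holds, by `rusin_sverak_leray_weak_stability_of_three_leaves`
applied to `jia_sverak_2013_lemma_2_holds`, `jia_sverak_2013_lemma_8_holds` and
`localLeray_limit_isLocalLeraySolution_holds`.
[cite: RusinSverak2011, Thm. 4.2 with Lemma 4.1 and Prop. 2.2 (arXiv:0911.0500 pp. 4, 7)] -/
theorem rusin_sverak_leray_weak_stability_holds : rusin_sverak_leray_weak_stability :=
  rusin_sverak_leray_weak_stability_of_three_leaves jia_sverak_2013_lemma_2_holds
    jia_sverak_2013_lemma_8_holds localLeray_limit_isLocalLeraySolution_holds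

/-- **Rusin–Šverák 2011, stability of singular points (Thm. 4.2 with Lemma 2.1, proof of
Cor. 4.2), discharged**: the named fact `rusin_sverak_leray_singular_points_stable` holds — Leray
solutions of data bounded and weakly convergent in `Ḣ^{1/2}`, singular at `(T, x_k)` with
`x_k → x_∞`, yield a Leray solution of the weak-limit datum singular at `(T, x_∞)`. By
`rusin_sverak_leray_singular_points_stable_of_three_leaves` applied to the three discharged leaves.
[cite: RusinSverak2011, Thm. 4.2 with Lemma 2.1, proof of Cor. 4.2 (arXiv:0911.0500 pp. 4, 7–8)] -/
theorem rusin_sverak_leray_singular_points_stable_holds :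
    rusin_sverak_leray_singular_points_stable :=
  rusin_sverak_leray_singular_points_stable_of_three_leaves jia_sverak_2013_lemma_2_holds
    jia_sverak_2013_lemma_8_holds localLeray_limit_isLocalLeraySolution_holds

end Literature.Analysis.FluidPDE

end
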